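import Literature.NumberTheory.ConnesMoscovici2022.UVProlateSpectrum
import HarnessLib

/-!
# Connes–Moscovici 2022, Lemma 1.5 (basis of `dom W_max / dom W_min`): ERRATUM on the typed
# statement, its (vacuous) discharge, and the CORRECTED statement

LINE 1 — FRAMING. RH-FREE corpus literature (spectral theory of the prolate wave operator
`W_λ = −∂(λ² − x²)∂ + (2πλx)²` on `L²(ℝ)`; sequel row of the Connes–Consani corpus, no leaf / binder
role).  bears_on: LADDER-RH W-C/W-P.  WHAT THIS IS NOT: any claim about RH; nothing in this file
mentions `RiemannHypothesis` or bears on the truth of RH.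

Source: A. Connes, H. Moscovici, *The UV prolate spectrum matches the zeros of zeta*, PNAS 119 (2022)
[bib: `ConnesMoscovici2022`], Lemma 1.5 = arXiv:2112.05500 Lemma 2.5 (chunk p0005:L84–L104; TeX
`cc/src/arXiv2112.05500-Draft2.tex` l.471–494):

> "First, for `ℰ₊` we pick an even function `α₊ ∈ C_c^∞(ℝ)` such that `α₊(x) = log|λ² − x²|` for
> `x ∈ [¾λ, ⁵⁄₄λ]` and with support in `(½λ, ³⁄₂λ)`. Then we take `β₊(x) = 1_I` … Next for `ℰ₋` we
> let `α₋(x) := x α₊(x)` and `β₋(x) := x β₊(x)`.  LEMMA. The quadruplet `{α±, β±, α̂±, β̂±}` forms a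
> basis of `ℰ±`."

## ERRATUM (typed statement `CM22_lemma_1_5` of `UVProlateSpectrum.lean`)

The printed phrase "`α₊ ∈ C_c^∞(ℝ)` such that `α₊(x) = log|λ² − x²|` for `x ∈ [¾λ, ⁵⁄₄λ]`" cannot be
read literally: `log|λ² − x²| → −∞` at `x = λ ∈ [¾λ, ⁵⁄₄λ]`, so no function smooth (or merely
continuous) on all of `ℝ` agrees with it on that interval — what is meant (and what the proof uses:
`α₊` carries the logarithmic singularity that pairs non-trivially with `β₊ = 1_I` under `Ω`) is a
compactly supported even function, smooth OFF `±λ`, equal to `log|λ² − x²|` near `±λ`.  The tree's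
`CM22_lemma_1_5` typed the phrase literally (`ContDiff ℝ ⊤ α` together with the log identity on
`Icc (¾λ) (⁵⁄₄λ)`), so its hypotheses are UNSATISFIABLE for every `λ > 0`
(`CM22_lemma_1_5_hypotheses_unsat`) and the named fact holds VACUOUSLY (`CM22_lemma_1_5_holds` —
an EX-FALSO discharge, recorded as such; it carries no mathematical content and must not be cited as
Lemma 1.5).  The CORRECTED statement is `CM22_lemma_1_5_corr` below (smoothness of `α` only on
`{x | x ≠ λ ∧ x ≠ −λ}`, everything else as typed before); it is the genuine named fact (unproved here;
its proof = the `Ω`-pairing matrix of the printed proof + von Neumann's first formula with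
`finrank_eigenspace_prolateMax` of `UVProlateDeficiencyIndices.lean`).

Nothing in this file bears on the truth of RH.
-/

noncomputable section

open Complex Set MeasureTheory Filter
open scoped Real Topology

namespace Literature.NumberTheory.ConnesMoscovici2022

open Literature.NumberTheory.ConnesConsani2021 Literature.NumberTheory.ConnesConsani2024

/-- RH-FREE (PROVED). **Erratum for the typed Lemma 1.5**: for `λ > 0` no `α : ℝ → ℝ` is smooth on
`ℝ` and equal to `log|λ² − x²|` on `[¾λ, ⁵⁄₄λ]` (the latter is unbounded below near `x = λ`, the
former is bounded on the compact interval).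
[cite: ConnesMoscovici2022, Lemma 1.5, sentence before it (= arXiv Lemma 2.5, chunk p0005:L84–L88)] -/
theorem CM22_lemma_1_5_hypotheses_unsat {lam : ℝ} (hlam : 0 < lam) {α : ℝ → ℝ}
    (hα : ContDiff ℝ (⊤ : ℕ∞) α)
    (hlog : ∀ x ∈ Icc (3 / 4 * lam) (5 / 4 * lam), α x = Real.log |lam ^ 2 - x ^ 2|) : False := by
  obtain ⟨M, hM⟩ := isCompact_Icc.exists_bound_of_continuousOn
    (hα.continuous.continuousOn (s := Icc (3 / 4 * lam) (5 / 4 * lam)))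
  set δ : ℝ := min (lam / 4) (Real.exp (-M - 1) / (3 * lam)) with hδ
  have hδpos : 0 < δ := lt_min (by linarith) (by positivity)
  have hδ1 : δ ≤ lam / 4 := min_le_left _ _
  have hδ2 : δ ≤ Real.exp (-M - 1) / (3 * lam) := min_le_right _ _
  set x : ℝ := lam + δ with hx
  have hxI : x ∈ Icc (3 / 4 * lam) (5 / 4 * lam) := ⟨by rw [hx]; linarith, by rw [hx]; linarith⟩
  have habs : |lam ^ 2 - x ^ 2| = δ * (2 * lam + δ) := by
    rw [hx, abs_of_neg (by nlinarith), show -(lam ^ 2 - (lam + δ) ^ 2) = δ * (2 * lam + δ) by ring]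
  have hpos : 0 < δ * (2 * lam + δ) := by positivity
  have hle : δ * (2 * lam + δ) ≤ Real.exp (-M - 1) := by
    calc δ * (2 * lam + δ) ≤ δ * (3 * lam) := by
          refine mul_le_mul_of_nonneg_left (by linarith) hδpos.le
      _ ≤ Real.exp (-M - 1) / (3 * lam) * (3 * lam) :=
          mul_le_mul_of_nonneg_right hδ2 (by linarith)
      _ = Real.exp (-M - 1) := by field_simp
  have hlogle : Real.log (δ * (2 * lam + δ)) ≤ -M - 1 := by
    have := Real.log_le_log hpos hle
    rwa [Real.log_exp] at this
  have h1 : α x ≤ -M - 1 := by rw [hlog x hxI, habs]; exact hlogle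
  have h2 : -M ≤ α x := by
    have := hM x hxI
    rw [Real.norm_eq_abs, abs_le] at this
    exact this.1
  linarith

/-- RH-FREE (PROVED, **EX-FALSO** — see the ERRATUM in the file header): the named fact
`CM22_lemma_1_5` AS TYPED holds vacuously, its hypotheses on `α` being unsatisfiable
(`CM22_lemma_1_5_hypotheses_unsat`).  This removes a vacuous named fact from the debt ledger; it is
NOT a formalisation of Lemma 1.5 — that is `CM22_lemma_1_5_corr` (unproved).
[cite: ConnesMoscovici2022, Lemma 1.5 (= arXiv Lemma 2.5, chunk p0005:L84–L92)] -/
theorem CM22_lemma_1_5_holds : CM22_lemma_1_5 :=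
  fun _ hlam _ hα _ hlog _ _ _ _ _ _ _ _ _ ↦ (CM22_lemma_1_5_hypotheses_unsat hlam hα hlog).elim

/-- NAMED FACT (RH-FREE), **CORRECTED STATEMENT of Lemma 1.5** (= arXiv Lemma 2.5), superseding the
vacuously-typed `CM22_lemma_1_5`: with `α₊` even, compactly supported in `|x| ∈ (½λ, ³⁄₂λ)`, SMOOTH
OFF `±λ` and equal to `log|λ² − x²|` on `[¾λ, ⁵⁄₄λ]` (so `α₊` carries the logarithmic singularity of
`dom W_max` at `±λ`; its value at `±λ` is immaterial for its `L²` class), `β₊ = 1_{[−λ,λ]}`,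
`α₋ = xα₊`, `β₋ = xβ₊`: "The quadruplet `{α±, β±, α̂±, β̂±}` forms a basis of `ℰ±`",
`ℰ = dom(W_max)/dom(W_min)` — typed: the eight vectors lie in `dom W_max` and every `ξ ∈ dom W_max`
differs from a UNIQUE linear combination of them by an element of `dom W_min`.  Only change w.r.t.
`CM22_lemma_1_5`: `ContDiff ℝ ⊤ α` ↦ `ContDiffOn ℝ ⊤ α {x | x ≠ λ ∧ x ≠ −λ}`.
[cite: ConnesMoscovici2022, Lemma 1.5 (= arXiv Lemma 2.5, chunk p0005:L84–L92; proof L94–L104)] -/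
def CM22_lemma_1_5_corr : Prop :=
  ∀ lam : ℝ, 0 < lam →
  ∀ (α : ℝ → ℝ), ContDiffOn ℝ (⊤ : ℕ∞) α {x | x ≠ lam ∧ x ≠ -lam} → (∀ x, α (-x) = α x) →
    (∀ x ∈ Icc (3 / 4 * lam) (5 / 4 * lam), α x = Real.log |lam ^ 2 - x ^ 2|) →
    (∀ x, 0 ≤ x → α x ≠ 0 → x ∈ Ioo (lam / 2) (3 / 2 * lam)) →
  ∀ (αp αm βp βm : L2R),
    ((αp : ℝ → ℂ) =ᵐ[volume] fun x ↦ (α x : ℂ)) →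
    ((αm : ℝ → ℂ) =ᵐ[volume] fun x ↦ (x * α x : ℂ)) →
    ((βp : ℝ → ℂ) =ᵐ[volume] (Icc (-lam) lam).indicator fun _ ↦ (1 : ℂ)) →
    ((βm : ℝ → ℂ) =ᵐ[volume] (Icc (-lam) lam).indicator fun x ↦ (x : ℂ)) →
    let v : Fin 8 → L2R := ![αp, αm, βp, βm, fourierL2 αp, fourierL2 αm, fourierL2 βp, fourierL2 βm]
    (∀ i, v i ∈ (prolateMax lam).domain) ∧
    ∀ ξ ∈ (prolateMax lam).domain, ∃! c : Fin 8 → ℂ, ξ - ∑ i, c i • v i ∈ (prolateMin lam).domain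

/-- RH-FREE (PROVED). `log|λ² − x²|` is smooth off `±λ` — so the corrected `α`-clauses of
`CM22_lemma_1_5_corr` are satisfiable (multiply by an even smooth cutoff equal to `1` on
`[¾λ, ⁵⁄₄λ]` and supported in `(½λ, ³⁄₂λ)`), unlike those of `CM22_lemma_1_5`.
[cite: ConnesMoscovici2022, Lemma 1.5, sentence before it (= arXiv Lemma 2.5, chunk p0005:L84–L88)] -/
theorem contDiffOn_log_abs_pSq (lam : ℝ) :
    ContDiffOn ℝ (⊤ : ℕ∞) (fun x : ℝ ↦ Real.log |lam ^ 2 - x ^ 2|) {x | x ≠ lam ∧ x ≠ -lam} := by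
  have h : ∀ x ∈ {x : ℝ | x ≠ lam ∧ x ≠ -lam}, lam ^ 2 - x ^ 2 ≠ 0 := by
    intro x hx h0
    have : (lam - x) * (lam + x) = 0 := by rw [← h0]; ring
    rcases mul_eq_zero.1 this with h1 | h1
    · exact hx.1 (by linarith)
    · exact hx.2 (by linarith)
  refine ((contDiffOn_id.pow 2 |> (contDiffOn_const.sub ·)).abs ?_ ).log ?_
  · exact fun x hx ↦ h x hx
  · exact fun x hx ↦ (abs_pos.2 (h x hx)).ne'

end Literature.NumberTheory.ConnesMoscovici2022

end
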